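import Literature.AlgebraicGeometry.ModuliOfAbelianVarieties.SiegelFamilyHumbertRungeConjugacy
import Literature.AlgebraicGeometry.ModuliOfAbelianVarieties.SiegelFamilyHumbertQuadraticOrder
import HarnessLib

/-!
# Runge's discriminant form of a pair of singular relations and the anticommutator of two Rosati-invariant
# matrices: `αβ + βα = t(α)β + t(β)α − n(α, β)` (Runge 1999, §6 Lemma 8), `γ = αβ − βα`, `γ² = ¼(Δ(α,β)² − Δ(α)Δ(β))`
# (Runge 1999, §6 proof of Thm. 7)

Layer `Literature/AlgebraicGeometry/ModuliOfAbelianVarieties`, namespace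
`Literature.AlgebraicGeometry.ModuliOfAbelianVarieties.SiegelModuli`; lane `lit-hodgefound` (Track 2 foundations
library, Layer A4 "cycle classes / Hodge classes / Lefschetz (1,1)"), seat `lit-hodgefound-skel-4`, row **A4-66**,
FILE 1. Sequel of rows A4-59′ (`SiegelFamilyHumbertEndomorphism`: B–W's `R₀(q) = humbertRatRep q`, `R₀² = bR₀ − (ac + de)`),
A4-64 FILE 5 (`SiegelFamilyHumbertQuadraticOrder`: `humbertNormTerm q = ac + de`) and A4-65 FILE 3
(`SiegelFamilyHumbertRungeConjugacy`: Runge's Rosati-invariant integer matrices `X(n, q) = rosatiMatrix n q = n·1 + R₀(q)`,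
`humbertRatRep_add`). PURE MATRIX ALGEBRA over `ℤ` (no point of `𝔥₂` is needed): the relations between the rational
representations of TWO symmetric endomorphisms `α = X(m, q)`, `β = X(n, q′)` attached to two singular relations
`q = (a, b, c, d, e)`, `q′ = (a′, b′, c′, d′, e′)`.

## Source followed, verbatim (B. Runge, *Endomorphism rings of abelian surfaces and projective models of their moduli
## spaces*, Tohoku Math. J. 51 (1999), held text `paper:doi-10-2748-tmj-1178224764`)

* §4, p. 288 (p0006): "A Rosati invariant matrix is of type `M = M̄ = (a₁ a₂ 0 b; a₃ a₄ −b 0; 0 c a₁ a₃; −c 0 a₂ a₄)` […]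
  Any Rosati invariant matrix `M` satisfies `M² − Tr(A)M + det(A) + bc = 0`, and hence has the reduced Trace
  `t(M) = Tr(A)` and the discriminant `Δ(M) = Tr(A)² − 4(det(A) + bc) = (a₁ − a₄)² + 4(a₂a₃ − bc)`."
* §6, p. 294 (p0012): "In a rational quaternion algebra `A` any element satisfies an equation `x² − t(x)x + n(x) = 0`, where
  `t(x)` and `n(x)` are called the reduced trace and norm […]. The main anti-involution is defined by `x̄ = t(x) − x` and
  the "Zwischennorm" is defined by `n(x, y) = n(x + y) − n(x) − n(y) = n(y, x) = t(x)t(y) − t(xy) = xȳ + yx̄ = ȳx + x̄y`.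
  The discriminant form is defined by `Δ(x, y) = ½(Δ(x + y) − Δ(x) − Δ(y)) = 2t(xy) − t(x)t(y) = t(x)t(y) − 2n(x, y)`,
  […] Obviously, `n(x, x) = 2n(x) = 2xx̄`, `Δ(x) = Δ(x, x) = t(x)² − 4n(x)` and `n(x, 1) = t(x)`."
* §6, p. 295 (p0013), **LEMMA 8.** "Let `α` and `β` be Rosati invariant elements of `M₄(ℚ)`. Then it holds that
  `αβ + βα = t(α)β + t(β)α − n(α, β)`. In particular, if `ℚ(α)` and `ℚ(β)` are real quadratic fields such that
  `ℚ(α) ≠ ℚ(β)`, then `ℚ(α, β)` is a quaternion algebra. PROOF. This can be shown by routine calculation, which we omit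
  here."
* §6, p. 295 (p0013), proof of **THEOREM 7** ("Any QCM-order can be written as `R = ℤ ⊕ ℤα ⊕ ℤβ ⊕ ℤαβ`, where `α` and
  `β` are primitive Rosati invariant elements of positive discriminant `Δ(α)`, `Δ(β)`, such that the discriminant matrix
  `S_Δ = (Δ(α) Δ(α,β); Δ(α,β) Δ(β))` is positive definite. The discriminant of `R` is `d(R) = det(S_Δ)/4`."): "Moreover,
  up to multiplication by a non-zero rational number, the element `γ = αβ − βα` is a unique element with `γ̄ = −γ`. The
  algebra `R ⊗ ℚ` is admissible if and only if `γ² = −n(γ) = (Δ(α, β)² − Δ(α)Δ(β))/4` is a negative number."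

## Dictionary (the tree's parametrisation of Rosati-invariant integer matrices)

Every Rosati-invariant `M = (A B; C ᵗA) ∈ M₄(ℤ)` (`A = (a₁ a₂; a₃ a₄)`, `B = bJ₁`, `C = cJ₁`) is `X(n, q) = n·1 + R₀(q)` with
`n = a₁`, `q = (a₂, a₄ − a₁, −a₃, b, c)` (`rosatiMatrix`, row A4-65 FILE 3; `rosatiMatrix_injective`). In these
coordinates (here `q = (a, b, c, d, e)` again denotes the relation vector):
* reduced trace `t(X(n, q)) = Tr(A) = 2n + b` (`redTrace n q`; the matrix trace is `2t`, `trace_rosatiMatrix`);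
* reduced norm `n(X(n, q)) = det(A) + bc = n² + nb + (ac + de)` (`redNorm n q`; `ac + de = humbertNormTerm q`);
* `Δ(X(n, q)) = t² − 4n = b² − 4ac − 4de = humbertInvariant q` (`redTrace_sq_sub_four_mul_redNorm`);
* Zwischennorm `n(X(m,q), X(n,q′)) = 2mn + mb′ + nb + (ac′ + a′c + de′ + d′e)` (`redNormPolar`, `humbertNormPolar q q′`);
* discriminant form `Δ(X(m,q), X(n,q′)) = t t′ − 2n(·,·) = bb′ − 2(ac′ + a′c) − 2(de′ + d′e) = humbertPolar q q′` — the
  polar bilinear form of Humbert's invariant `Δ(q) = b² − 4ac − 4de` (`humbertPolar_self`, `humbertInvariant_add`),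
  independent of the trace parameters `m, n`;
* `γ = αβ − βα = R₀(q)R₀(q′) − R₀(q′)R₀(q) = humbertComm q q′` (independent of `m, n`).

## Contents (definitions with bodies and proved theorems; NO named fact, net debt 0)

* §1 `humbertPolar`, `humbertPolar_self` (`Δ(q,q) = Δ(q)`), symmetry, bilinearity, `humbertInvariant_add`
  (`Δ(q + q′) = Δ(q) + 2Δ(q,q′) + Δ(q′)`), `two_mul_humbertPolar` (Runge's `Δ(x,y) = ½(Δ(x+y) − Δ(x) − Δ(y))`),
  `humbertInvariant_add_smul_smul` (`Δ(xq + yq′) = x²Δ(q) + 2xyΔ(q,q′) + y²Δ(q′)`), `map_humbertPolar`; `humbertNormPolar`,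
  `humbertNormTerm_add`, `humbertPolar_eq_mul_sub_two_mul_humbertNormPolar` (`Δ(q,q′) = bb′ − 2N(q,q′)`).
* §2 **RUNGE'S LEMMA 8**: `humbertRatRep_mul_add_mul` (`R₀R₀′ + R₀′R₀ = bR₀′ + b′R₀ − N(q,q′)·1`); the reduced trace / norm
  `redTrace`, `redNorm`, `redNormPolar` of `X(n, q)` with `rosatiMatrix_mul_self` (`X² = tX − n·1`, p. 288),
  `trace_rosatiMatrix_eq_two_mul_redTrace`, `redTrace_sq_sub_four_mul_redNorm` (`= Δ(q)`), `redNormPolar_eq`,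
  **`rosatiMatrix_mul_add_mul`** (`αβ + βα = t(α)β + t(β)α − n(α,β)·1`, Lemma 8 verbatim on `X(m,q)`, `X(n,q′)`),
  `redTrace_mul_sub_two_mul_redNormPolar` (`t(α)t(β) − 2n(α,β) = Δ(q,q′)`: the discriminant form is Humbert's polar form).
* §3 the commutator `γ`: `humbertComm`, `rosatiMatrix_mul_sub_mul` (`αβ − βα = γ` for all trace parameters),
  `humbertComm_self`, `humbertComm_swap`, `humbertComm_smul_right` (`γ(q, cq) = 0`), `rosati_humbertComm` (**`γ̄ = −γ`**:
  `γ` is Rosati-SKEW for the principal polarisation), `trace_humbertComm` (`= 0`),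
  `humbertRatRep_mul_humbertComm_add` (`R₀γ + γR₀ = bγ`, i.e. `γ` ANTICOMMUTES with `2R₀ − b`),
  **`four_smul_humbertComm_mul_self`** (`4γ² = (Δ(q,q′)² − Δ(q)Δ(q′))·1`, Runge's `γ² = (Δ(α,β)² − Δ(α)Δ(β))/4`).
* §4 the square roots `humbertSqrt q = 2R₀(q) − b·1` (`(2R₀ − b)² = Δ(q)·1`, row A4-59′): `humbertSqrt_mul_self`,
  **`humbertSqrt_mul_add_mul`** (`α₀β₀ + β₀α₀ = 2Δ(q,q′)·1`), `humbertSqrt_mul_sub_mul` (`α₀β₀ − β₀α₀ = 4γ`),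
  `humbertSqrt_mul_humbertComm` (`α₀γ = −γα₀`), `rosati_humbertSqrt` — the relations of a quaternionic basis
  `(1, α₀, 2γ, 2α₀γ)` with `α₀² = Δ(q)`, `(2γ)² = Δ(q,q′)² − Δ(q)Δ(q′) = −det S_Δ`, consumed by FILE 2
  (`SiegelFamilyHumbertQuaternionAlgebra`: `ℚ(α, β) ≅ (Δ(q), −det S_Δ)_ℚ`).

## Scope

* Lemma 8's second sentence ("`ℚ(α) ≠ ℚ(β)` real quadratic fields ⟹ `ℚ(α, β)` is a quaternion algebra") and Theorem 7
  (structure of QCM-orders, `d(R) = det(S_Δ)/4`) are NOT asserted here; FILE 2 proves that `ℚ(α, β) = ℚ ⊕ ℚα ⊕ ℚβ ⊕ ℚαβ`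
  is a quaternion algebra under the hypothesis `det S_Δ ≠ 0`, `Δ(q) ≠ 0` (automatic at a point of `𝔥₂` lying on two
  different Humbert surfaces, FILE 3), which is what Runge's Theorem 7 uses.
* "Rosati invariant element of `M₄(ℚ)`" is rendered through the tree's parametrisation `X(n, q)`, `n ∈ ℤ`, `q ∈ ℤ⁵`
  (integer matrices; the rational case is the same identity after `⊗ ℚ`, `map_humbertPolar`).

## References

* [Runge1999EndomorphismRingsAbelianSurfaces] B. Runge, *Endomorphism rings of abelian surfaces and projective models of
  their moduli spaces*, Tohoku Math. J. 51 (1999) 283–303, §4 p. 288; §6 pp. 294–295 (Thm. 7, Lemma 8).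
* [BirkenhakeWilhelm2003] Ch. Birkenhake, H. Wilhelm, *Humbert surfaces and the Kummer plane*, Trans. AMS 355 (2003),
  §4 eq. (9), Prop. 4.3, Cor. 4.4 (pp. 1827–1828).
-/

noncomputable section

open Matrix Module Function

namespace Literature.AlgebraicGeometry.ModuliOfAbelianVarieties

namespace SiegelModuli

open Literature.Geometry.Kaehler Literature.Geometry.Kaehler.ComplexTorus

/-! ## §1 The polar form `Δ(q, q′)` of Humbert's invariant and the Zwischennorm term `N(q, q′)` -/

section Polar

variable {R : Type*} [CommRing R]

/-- **Runge's discriminant form `Δ(α, β) = ½(Δ(α + β) − Δ(α) − Δ(β))` on relation vectors**: the symmetric bilinear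
form `Δ(q, q′) = bb′ − 2(ac′ + a′c) − 2(de′ + d′e)` whose quadratic form is Humbert's invariant
`Δ(q) = b² − 4ac − 4de` (`humbertPolar_self`). [cite: Runge1999EndomorphismRingsAbelianSurfaces, §6 p. 294 ("The discriminant form is defined by `Δ(x,y) = ½(Δ(x+y) − Δ(x) − Δ(y))`")] -/
def humbertPolar (q q' : Fin 5 → R) : R :=
  q 1 * q' 1 - 2 * (q 0 * q' 2 + q' 0 * q 2) - 2 * (q 3 * q' 4 + q' 3 * q 4)

/-- Unfolding of `humbertPolar`. [cite: Runge1999EndomorphismRingsAbelianSurfaces, §6 p. 294] -/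
theorem humbertPolar_apply (q q' : Fin 5 → R) :
    humbertPolar q q' = q 1 * q' 1 - 2 * (q 0 * q' 2 + q' 0 * q 2) - 2 * (q 3 * q' 4 + q' 3 * q 4) := rfl

/-- **`Δ(q, q) = Δ(q)`** ("`Δ(x) = Δ(x, x)`"). [cite: Runge1999EndomorphismRingsAbelianSurfaces, §6 p. 294] -/
theorem humbertPolar_self (q : Fin 5 → R) : humbertPolar q q = humbertInvariant q := by
  simp only [humbertPolar, humbertInvariant]; ring

/-- `Δ(q, q′) = Δ(q′, q)`. [cite: Runge1999EndomorphismRingsAbelianSurfaces, §6 p. 294] -/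
theorem humbertPolar_comm (q q' : Fin 5 → R) : humbertPolar q q' = humbertPolar q' q := by
  simp only [humbertPolar]; ring

/-- Additivity in the first argument. [cite: Runge1999EndomorphismRingsAbelianSurfaces, §6 p. 294] -/
theorem humbertPolar_add_left (q₁ q₂ q' : Fin 5 → R) :
    humbertPolar (q₁ + q₂) q' = humbertPolar q₁ q' + humbertPolar q₂ q' := by
  simp only [humbertPolar, Pi.add_apply]; ring

/-- Additivity in the second argument. [cite: Runge1999EndomorphismRingsAbelianSurfaces, §6 p. 294] -/
theorem humbertPolar_add_right (q q₁ q₂ : Fin 5 → R) :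
    humbertPolar q (q₁ + q₂) = humbertPolar q q₁ + humbertPolar q q₂ := by
  simp only [humbertPolar, Pi.add_apply]; ring

/-- Homogeneity in the first argument. [cite: Runge1999EndomorphismRingsAbelianSurfaces, §6 p. 294] -/
theorem humbertPolar_smul_left (c : R) (q q' : Fin 5 → R) : humbertPolar (c • q) q' = c * humbertPolar q q' := by
  simp only [humbertPolar, Pi.smul_apply, smul_eq_mul]; ring

/-- Homogeneity in the second argument. [cite: Runge1999EndomorphismRingsAbelianSurfaces, §6 p. 294] -/
theorem humbertPolar_smul_right (c : R) (q q' : Fin 5 → R) : humbertPolar q (c • q') = c * humbertPolar q q' := by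
  simp only [humbertPolar, Pi.smul_apply, smul_eq_mul]; ring

/-- `Δ(−q, q′) = −Δ(q, q′)`. [cite: Runge1999EndomorphismRingsAbelianSurfaces, §6 p. 294] -/
theorem humbertPolar_neg_left (q q' : Fin 5 → R) : humbertPolar (-q) q' = -humbertPolar q q' := by
  simp only [humbertPolar, Pi.neg_apply]; ring

/-- `Δ(q, 0) = 0`. [cite: Runge1999EndomorphismRingsAbelianSurfaces, §6 p. 294] -/
theorem humbertPolar_zero_right (q : Fin 5 → R) : humbertPolar q 0 = 0 := by
  simp [humbertPolar]

/-- **Polarisation: `Δ(q + q′) = Δ(q) + 2Δ(q, q′) + Δ(q′)`.** [cite: Runge1999EndomorphismRingsAbelianSurfaces, §6 p. 294] -/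
theorem humbertInvariant_add (q q' : Fin 5 → R) :
    humbertInvariant (q + q') = humbertInvariant q + 2 * humbertPolar q q' + humbertInvariant q' := by
  simp only [humbertPolar, humbertInvariant, Pi.add_apply]; ring

/-- **Runge's definition, literally: `2Δ(q, q′) = Δ(q + q′) − Δ(q) − Δ(q′)`** ("`Δ(x, y) = ½(Δ(x + y) − Δ(x) − Δ(y))`").
[cite: Runge1999EndomorphismRingsAbelianSurfaces, §6 p. 294] -/
theorem two_mul_humbertPolar (q q' : Fin 5 → R) :
    2 * humbertPolar q q' = humbertInvariant (q + q') - humbertInvariant q - humbertInvariant q' := by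
  rw [humbertInvariant_add]; ring

/-- **The invariant on the pencil spanned by two relations: `Δ(xq + yq′) = x²Δ(q) + 2xyΔ(q, q′) + y²Δ(q′)`** — the binary
quadratic form with Gram ("discriminant") matrix `S_Δ = (Δ(q) Δ(q,q′); Δ(q,q′) Δ(q′))`.
[cite: Runge1999EndomorphismRingsAbelianSurfaces, §6 Thm. 7 (p. 295, the discriminant matrix `S_Δ`)] -/
theorem humbertInvariant_add_smul_smul (x y : R) (q q' : Fin 5 → R) :
    humbertInvariant (x • q + y • q') =
      x ^ 2 * humbertInvariant q + 2 * x * y * humbertPolar q q' + y ^ 2 * humbertInvariant q' := by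
  simp only [humbertPolar, humbertInvariant, Pi.add_apply, Pi.smul_apply, smul_eq_mul]; ring

/-- The polar form commutes with ring maps (e.g. `ℤ → ℚ → ℝ → ℂ`). [cite: Runge1999EndomorphismRingsAbelianSurfaces, §6 p. 294] -/
theorem map_humbertPolar {S : Type*} [CommRing S] (f : R →+* S) (q q' : Fin 5 → R) :
    f (humbertPolar q q') = humbertPolar (fun i ↦ f (q i)) (fun i ↦ f (q' i)) := by
  simp [humbertPolar, map_sub, map_mul, map_add, map_ofNat]

end Polar

section NormPolar

/-- **The relation part of Runge's Zwischennorm: `N(q, q′) = ac′ + a′c + de′ + d′e`**, the polar form of B–W's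
`N_a(f₀) = ac + de = humbertNormTerm q` (`humbertNormTerm_add`); `n(X(m,q), X(n,q′)) = 2mn + mb′ + nb + N(q, q′)`
(`redNormPolar_eq`). [cite: Runge1999EndomorphismRingsAbelianSurfaces, §6 p. 294 ("`n(x, y) = n(x + y) − n(x) − n(y)`")] -/
def humbertNormPolar (q q' : Fin 5 → ℤ) : ℤ := q 0 * q' 2 + q' 0 * q 2 + q 3 * q' 4 + q' 3 * q 4

/-- Unfolding of `humbertNormPolar`. [cite: Runge1999EndomorphismRingsAbelianSurfaces, §6 p. 294] -/
theorem humbertNormPolar_apply (q q' : Fin 5 → ℤ) :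
    humbertNormPolar q q' = q 0 * q' 2 + q' 0 * q 2 + q 3 * q' 4 + q' 3 * q 4 := rfl

/-- `N(q, q′) = N(q′, q)`. [cite: Runge1999EndomorphismRingsAbelianSurfaces, §6 p. 294 ("`n(x, y) = n(y, x)`")] -/
theorem humbertNormPolar_comm (q q' : Fin 5 → ℤ) : humbertNormPolar q q' = humbertNormPolar q' q := by
  simp only [humbertNormPolar]; ring

/-- `N(q, q) = 2(ac + de)` ("`n(x, x) = 2n(x)`"). [cite: Runge1999EndomorphismRingsAbelianSurfaces, §6 p. 294] -/
theorem humbertNormPolar_self (q : Fin 5 → ℤ) : humbertNormPolar q q = 2 * humbertNormTerm q := by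
  simp only [humbertNormPolar, humbertNormTerm]; ring

/-- **`N_a` is quadratic with polar form `N`: `(ac + de)(q + q′) = (ac + de)(q) + N(q, q′) + (ac + de)(q′)`.**
[cite: Runge1999EndomorphismRingsAbelianSurfaces, §6 p. 294 ("`n(x, y) = n(x + y) − n(x) − n(y)`")] -/
theorem humbertNormTerm_add (q q' : Fin 5 → ℤ) :
    humbertNormTerm (q + q') = humbertNormTerm q + humbertNormPolar q q' + humbertNormTerm q' := by
  simp only [humbertNormTerm, humbertNormPolar, Pi.add_apply]; ring

/-- **`Δ(q, q′) = bb′ − 2N(q, q′)`** (the relation part of "`Δ(x, y) = t(x)t(y) − 2n(x, y)`").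
[cite: Runge1999EndomorphismRingsAbelianSurfaces, §6 p. 294] -/
theorem humbertPolar_eq_mul_sub_two_mul_humbertNormPolar (q q' : Fin 5 → ℤ) :
    humbertPolar q q' = q 1 * q' 1 - 2 * humbertNormPolar q q' := by
  simp only [humbertPolar, humbertNormPolar]; ring

end NormPolar

/-! ## §2 Runge's Lemma 8: `αβ + βα = t(α)β + t(β)α − n(α, β)` -/

section LemmaEight

/-- **RUNGE'S LEMMA 8 for the relation parts `R₀ = R₀(q)`, `R₀′ = R₀(q′)`:
`R₀R₀′ + R₀′R₀ = b·R₀′ + b′·R₀ − (ac′ + a′c + de′ + d′e)·1`** — the polarisation of B–W's `R₀² = bR₀ − (ac + de)·1`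
(row A4-59′ `humbertRatRep_mul_self`), by the "routine calculation" on `4 × 4` integer matrices.
[cite: Runge1999EndomorphismRingsAbelianSurfaces, §6 Lemma 8 (p. 295)] [cite: BirkenhakeWilhelm2003, §4 Cor. 4.4 (p. 1828)] -/
theorem humbertRatRep_mul_add_mul (q q' : Fin 5 → ℤ) :
    humbertRatRep q * humbertRatRep q' + humbertRatRep q' * humbertRatRep q =
      q 1 • humbertRatRep q' + q' 1 • humbertRatRep q - humbertNormPolar q q' • (1 : Matrix _ _ ℤ) := by
  ext i j
  rcases i with i | i <;> rcases j with j | j <;> fin_cases i <;> fin_cases j <;>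
    simp only [Matrix.mul_apply, Matrix.add_apply, Matrix.sub_apply, Matrix.smul_apply, Matrix.one_apply,
      smul_eq_mul, Fintype.sum_sum_type, Fin.sum_univ_two] <;> simp [humbertRatRep, humbertNormPolar] <;> ring

/-- **Runge's reduced trace `t(X(n, q)) = Tr(A) = 2n + b`** of the Rosati matrix `X(n, q) = n·1 + R₀(q)` (half the matrix
trace, `trace_rosatiMatrix_eq_two_mul_redTrace`). [cite: Runge1999EndomorphismRingsAbelianSurfaces, §4 p. 288 ("the reduced Trace `t(M) = Tr(A)`")] -/
def redTrace (n : ℤ) (q : Fin 5 → ℤ) : ℤ := 2 * n + q 1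

/-- **Runge's reduced norm `n(X(n, q)) = det(A) + bc = n² + nb + (ac + de)`** (B–W Prop. 4.3:
`N_a(n_X + mf₀) = n² + nmb + m²(ac + de)` at `m = 1`). [cite: Runge1999EndomorphismRingsAbelianSurfaces, §4 p. 288 ("`M² − Tr(A)M + det(A) + bc = 0`")] [cite: BirkenhakeWilhelm2003, §4 Prop. 4.3 (p. 1827)] -/
def redNorm (n : ℤ) (q : Fin 5 → ℤ) : ℤ := n ^ 2 + n * q 1 + humbertNormTerm q

/-- **Runge's Zwischennorm `n(α, β) = n(α + β) − n(α) − n(β)`** for `α = X(m, q)`, `β = X(n, q′)` (note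
`X(m, q) + X(n, q′) = X(m + n, q + q′)`). [cite: Runge1999EndomorphismRingsAbelianSurfaces, §6 p. 294] -/
def redNormPolar (m : ℤ) (q : Fin 5 → ℤ) (n : ℤ) (q' : Fin 5 → ℤ) : ℤ :=
  redNorm (m + n) (q + q') - redNorm m q - redNorm n q'

/-- Unfolding of `redTrace`. [cite: Runge1999EndomorphismRingsAbelianSurfaces, §4 p. 288] -/
theorem redTrace_apply (n : ℤ) (q : Fin 5 → ℤ) : redTrace n q = 2 * n + q 1 := rfl

/-- Unfolding of `redNorm`. [cite: Runge1999EndomorphismRingsAbelianSurfaces, §4 p. 288] -/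
theorem redNorm_apply (n : ℤ) (q : Fin 5 → ℤ) : redNorm n q = n ^ 2 + n * q 1 + humbertNormTerm q := rfl

/-- `X(m, q) + X(n, q′) = X(m + n, q + q′)`. [cite: Runge1999EndomorphismRingsAbelianSurfaces, §4 p. 288] -/
theorem rosatiMatrix_add (m n : ℤ) (q q' : Fin 5 → ℤ) :
    rosatiMatrix m q + rosatiMatrix n q' = rosatiMatrix (m + n) (q + q') := by
  rw [rosatiMatrix_eq_smul_one_add, rosatiMatrix_eq_smul_one_add, rosatiMatrix_eq_smul_one_add, humbertRatRep_add,
    add_smul]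
  abel

/-- **The matrix trace is twice the reduced trace: `tr X(n, q) = 2t(X(n, q))`** (`= 4n + 2b`, row A4-65 FILE 3
`trace_rosatiMatrix`). [cite: Runge1999EndomorphismRingsAbelianSurfaces, §4 p. 288] -/
theorem trace_rosatiMatrix_eq_two_mul_redTrace (n : ℤ) (q : Fin 5 → ℤ) :
    (rosatiMatrix n q).trace = 2 * redTrace n q := by
  rw [trace_rosatiMatrix, redTrace]; ring

/-- **"Any Rosati invariant matrix `M` satisfies `M² − Tr(A)M + det(A) + bc = 0`": `X(n,q)² = t·X(n,q) − n·1`.**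
[cite: Runge1999EndomorphismRingsAbelianSurfaces, §4 p. 288] [cite: BirkenhakeWilhelm2003, §4 Prop. 4.3 and Cor. 4.4 (pp. 1827–1828)] -/
theorem rosatiMatrix_mul_self (n : ℤ) (q : Fin 5 → ℤ) :
    rosatiMatrix n q * rosatiMatrix n q = redTrace n q • rosatiMatrix n q - redNorm n q • (1 : Matrix _ _ ℤ) := by
  rw [rosatiMatrix_eq_smul_one_add, redTrace, redNorm, humbertNormTerm, add_mul, mul_add, mul_add]
  simp only [smul_mul_assoc, mul_smul_comm, one_mul, mul_one, smul_smul, humbertRatRep_mul_self]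
  module

/-- **`Δ(M) = Tr(A)² − 4(det(A) + bc)` is Humbert's invariant: `t(X(n,q))² − 4n(X(n,q)) = Δ(q)`** (independent of `n`).
[cite: Runge1999EndomorphismRingsAbelianSurfaces, §4 p. 288] [cite: BirkenhakeWilhelm2003, §4 Prop. 4.3 (p. 1827: `Disc(n_X + mf₀) = m²(b² − 4ac − 4de)`)] -/
theorem redTrace_sq_sub_four_mul_redNorm (n : ℤ) (q : Fin 5 → ℤ) :
    redTrace n q ^ 2 - 4 * redNorm n q = humbertInvariant q := by
  simp only [redTrace, redNorm, humbertNormTerm, humbertInvariant]; ring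

/-- **The Zwischennorm in coordinates: `n(X(m,q), X(n,q′)) = 2mn + mb′ + nb + N(q, q′)`.**
[cite: Runge1999EndomorphismRingsAbelianSurfaces, §6 p. 294] -/
theorem redNormPolar_eq (m : ℤ) (q : Fin 5 → ℤ) (n : ℤ) (q' : Fin 5 → ℤ) :
    redNormPolar m q n q' = 2 * m * n + m * q' 1 + n * q 1 + humbertNormPolar q q' := by
  simp only [redNormPolar, redNorm, humbertNormTerm_add, Pi.add_apply]; ring

/-- `n(α, β) = n(β, α)`. [cite: Runge1999EndomorphismRingsAbelianSurfaces, §6 p. 294] -/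
theorem redNormPolar_comm (m : ℤ) (q : Fin 5 → ℤ) (n : ℤ) (q' : Fin 5 → ℤ) :
    redNormPolar m q n q' = redNormPolar n q' m q := by
  rw [redNormPolar_eq, redNormPolar_eq, humbertNormPolar_comm]; ring

/-- `n(α, α) = 2n(α)` ("`n(x, x) = 2n(x)`"). [cite: Runge1999EndomorphismRingsAbelianSurfaces, §6 p. 294] -/
theorem redNormPolar_self (n : ℤ) (q : Fin 5 → ℤ) : redNormPolar n q n q = 2 * redNorm n q := by
  rw [redNormPolar_eq, redNorm, humbertNormPolar_self]; ring

/-- `n(α, 1) = t(α)` ("`n(x, 1) = t(x)`"; `1 = X(1, 0)`). [cite: Runge1999EndomorphismRingsAbelianSurfaces, §6 p. 294] -/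
theorem redNormPolar_one (m : ℤ) (q : Fin 5 → ℤ) : redNormPolar m q 1 0 = redTrace m q := by
  rw [redNormPolar_eq, redTrace, humbertNormPolar]; simp only [Pi.zero_apply]; ring

/-- **RUNGE'S LEMMA 8 (Tohoku Math. J. 51, p. 295), AS PRINTED: "Let `α` and `β` be Rosati invariant elements of
`M₄(ℚ)`. Then it holds that `αβ + βα = t(α)β + t(β)α − n(α, β)`"** — for `α = X(m, q)`, `β = X(n, q′)` (every Rosati
invariant integer matrix is of this form, row A4-65 FILE 3), with `t = redTrace`, `n(·,·) = redNormPolar`.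
[cite: Runge1999EndomorphismRingsAbelianSurfaces, §6 Lemma 8 (p. 295)] -/
theorem rosatiMatrix_mul_add_mul (m : ℤ) (q : Fin 5 → ℤ) (n : ℤ) (q' : Fin 5 → ℤ) :
    rosatiMatrix m q * rosatiMatrix n q' + rosatiMatrix n q' * rosatiMatrix m q =
      redTrace m q • rosatiMatrix n q' + redTrace n q' • rosatiMatrix m q -
        redNormPolar m q n q' • (1 : Matrix _ _ ℤ) := by
  have h8 := humbertRatRep_mul_add_mul q q'
  rw [redNormPolar_eq, rosatiMatrix_eq_smul_one_add, rosatiMatrix_eq_smul_one_add, redTrace, redTrace]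
  -- expand both sides in the basis `1, R₀, R₀′` and the anticommutator
  have hL : (m • (1 : Matrix (Fin 2 ⊕ Fin 2) (Fin 2 ⊕ Fin 2) ℤ) + humbertRatRep q) * (n • 1 + humbertRatRep q') +
      (n • 1 + humbertRatRep q') * (m • 1 + humbertRatRep q) =
      (2 * m * n) • 1 + (2 * m) • humbertRatRep q' + (2 * n) • humbertRatRep q +
        (humbertRatRep q * humbertRatRep q' + humbertRatRep q' * humbertRatRep q) := by
    rw [add_mul, mul_add, mul_add, add_mul, mul_add, mul_add]
    simp only [smul_mul_assoc, mul_smul_comm, one_mul, mul_one, smul_smul]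
    module
  rw [hL, h8]
  module

/-- **The discriminant form is Humbert's polar form: `Δ(α, β) = t(α)t(β) − 2n(α, β) = Δ(q, q′)`** for `α = X(m, q)`,
`β = X(n, q′)` — independent of the trace parameters. [cite: Runge1999EndomorphismRingsAbelianSurfaces, §6 p. 294 ("`Δ(x, y) = … = t(x)t(y) − 2n(x, y)`")] -/
theorem redTrace_mul_sub_two_mul_redNormPolar (m : ℤ) (q : Fin 5 → ℤ) (n : ℤ) (q' : Fin 5 → ℤ) :
    redTrace m q * redTrace n q' - 2 * redNormPolar m q n q' = humbertPolar q q' := by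
  rw [redNormPolar_eq, humbertPolar_eq_mul_sub_two_mul_humbertNormPolar, redTrace, redTrace]; ring

/-- `Δ(α, α) = t(α)² − 4n(α) = Δ(q)` (consistency of the two printed formulas for `Δ(x)`).
[cite: Runge1999EndomorphismRingsAbelianSurfaces, §6 p. 294 ("`Δ(x) = Δ(x, x) = t(x)² − 4n(x)`")] -/
theorem redTrace_mul_sub_two_mul_redNormPolar_self (n : ℤ) (q : Fin 5 → ℤ) :
    redTrace n q * redTrace n q - 2 * redNormPolar n q n q = humbertInvariant q := by
  rw [redTrace_mul_sub_two_mul_redNormPolar, humbertPolar_self]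

end LemmaEight

/-! ## §3 The commutator `γ = αβ − βα`: Rosati-skew, `4γ² = (Δ(q,q′)² − Δ(q)Δ(q′))·1` -/

section Commutator

/-- **Runge's `γ = αβ − βα`** for `α = X(m, q)`, `β = X(n, q′)`: the commutator `R₀(q)R₀(q′) − R₀(q′)R₀(q)` of the relation
parts (the scalar parts cancel, `rosatiMatrix_mul_sub_mul`). [cite: Runge1999EndomorphismRingsAbelianSurfaces, §6 proof of Thm. 7 (p. 295: "the element `γ = αβ − βα`")] -/
def humbertComm (q q' : Fin 5 → ℤ) : Matrix (Fin 2 ⊕ Fin 2) (Fin 2 ⊕ Fin 2) ℤ :=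
  humbertRatRep q * humbertRatRep q' - humbertRatRep q' * humbertRatRep q

/-- Unfolding of `humbertComm`. [cite: Runge1999EndomorphismRingsAbelianSurfaces, §6 proof of Thm. 7 (p. 295)] -/
theorem humbertComm_def (q q' : Fin 5 → ℤ) :
    humbertComm q q' = humbertRatRep q * humbertRatRep q' - humbertRatRep q' * humbertRatRep q := rfl

/-- **`αβ − βα = γ`** for all trace parameters `m, n`. [cite: Runge1999EndomorphismRingsAbelianSurfaces, §6 proof of Thm. 7 (p. 295)] -/
theorem rosatiMatrix_mul_sub_mul (m : ℤ) (q : Fin 5 → ℤ) (n : ℤ) (q' : Fin 5 → ℤ) :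
    rosatiMatrix m q * rosatiMatrix n q' - rosatiMatrix n q' * rosatiMatrix m q = humbertComm q q' := by
  rw [rosatiMatrix_eq_smul_one_add, rosatiMatrix_eq_smul_one_add, humbertComm, add_mul, mul_add, mul_add, add_mul,
    mul_add, mul_add]
  simp only [smul_mul_assoc, mul_smul_comm, one_mul, mul_one, smul_smul]
  rw [mul_comm n m]
  abel

/-- `γ(q, q) = 0`. [cite: Runge1999EndomorphismRingsAbelianSurfaces, §6 proof of Thm. 7 (p. 295)] -/
theorem humbertComm_self (q : Fin 5 → ℤ) : humbertComm q q = 0 := sub_self _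

/-- `γ(q′, q) = −γ(q, q′)`. [cite: Runge1999EndomorphismRingsAbelianSurfaces, §6 proof of Thm. 7 (p. 295)] -/
theorem humbertComm_swap (q q' : Fin 5 → ℤ) : humbertComm q' q = -humbertComm q q' := by
  rw [humbertComm, humbertComm, neg_sub]

/-- `γ` is additive in the second argument. [cite: Runge1999EndomorphismRingsAbelianSurfaces, §6 proof of Thm. 7 (p. 295)] -/
theorem humbertComm_add_right (q q₁ q₂ : Fin 5 → ℤ) :
    humbertComm q (q₁ + q₂) = humbertComm q q₁ + humbertComm q q₂ := by
  simp only [humbertComm, humbertRatRep_add, mul_add, add_mul]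
  abel

/-- `γ(q, cq′) = cγ(q, q′)`. [cite: Runge1999EndomorphismRingsAbelianSurfaces, §6 proof of Thm. 7 (p. 295)] -/
theorem humbertComm_smul_right (c : ℤ) (q q' : Fin 5 → ℤ) : humbertComm q (c • q') = c • humbertComm q q' := by
  have hs : humbertRatRep (c • q') = c • humbertRatRep q' := by
    ext i j
    rcases i with i | i <;> rcases j with j | j <;> fin_cases i <;> fin_cases j <;>
      simp [humbertRatRep, Matrix.smul_apply]
  rw [humbertComm, humbertComm, hs, mul_smul_comm, smul_mul_assoc, smul_sub]

/-- **Proportional relations commute: `γ(q, cq) = 0`** (so `ℤ[X(m,q), X(n,cq)]` is commutative).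
[cite: Runge1999EndomorphismRingsAbelianSurfaces, §6 proof of Thm. 7 (p. 295)] -/
theorem humbertComm_smul_self (c : ℤ) (q : Fin 5 → ℤ) : humbertComm q (c • q) = 0 := by
  rw [humbertComm_smul_right, humbertComm_self, smul_zero]

/-- The principal type form `E₀ = typeForm 1` has unit determinant. [folklore] -/
private theorem isUnit_det_typeForm_one₁ : IsUnit (typeForm (fun _ : Fin 2 ↦ 1)).det := by
  rw [typeForm_one_eq_neg_J, Matrix.det_neg, Fintype.card_sum, Fintype.card_fin]
  norm_num
  exact Matrix.isUnit_det_J _ _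

/-- **"`γ̄ = −γ`": the commutator is SKEW for the Rosati (anti-)involution of the principal polarisation**
(`E₀⁻¹ ᵗγ E₀ = −γ`), because `α`, `β` are Rosati invariant and `‾(αβ) = β̄ ᾱ = βα`.
[cite: Runge1999EndomorphismRingsAbelianSurfaces, §6 proof of Thm. 7 (p. 295: "`γ = αβ − βα` is a unique element with `γ̄ = −γ`")] -/
theorem rosati_humbertComm (q q' : Fin 5 → ℤ) :
    rosati (typeForm (fun _ : Fin 2 ↦ 1)) (humbertComm q q') = -humbertComm q q' := by
  rw [humbertComm, rosati_sub, rosati_mul isUnit_det_typeForm_one₁, rosati_mul isUnit_det_typeForm_one₁,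
    rosati_humbertRatRep, rosati_humbertRatRep, neg_sub]

/-- `tr γ = 0` (a commutator). [cite: Runge1999EndomorphismRingsAbelianSurfaces, §6 proof of Thm. 7 (p. 295)] -/
theorem trace_humbertComm (q q' : Fin 5 → ℤ) : (humbertComm q q').trace = 0 := by
  rw [humbertComm, Matrix.trace_sub, Matrix.trace_mul_comm, sub_self]

/-- **`R₀γ + γR₀ = bγ`: the commutator anticommutes with the trace-free part `2R₀ − b` of `α`** (from Lemma 8 and
`R₀² = bR₀ − (ac + de)`: `R₀(R₀R₀′ − R₀′R₀) + (R₀R₀′ − R₀′R₀)R₀ = R₀(R₀R₀′ + R₀′R₀) − (R₀R₀′ + R₀′R₀)R₀ + [R₀², R₀′]·…`).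
[cite: Runge1999EndomorphismRingsAbelianSurfaces, §6 Lemma 8 and proof of Thm. 7 (p. 295)] -/
theorem humbertRatRep_mul_humbertComm_add (q q' : Fin 5 → ℤ) :
    humbertRatRep q * humbertComm q q' + humbertComm q q' * humbertRatRep q = q 1 • humbertComm q q' := by
  -- `R₀γ + γR₀ = R₀²R₀′ − R₀′R₀²` and `R₀² = bR₀ − n·1`
  have hsq := humbertRatRep_mul_self q
  have h1 : humbertRatRep q * humbertComm q q' + humbertComm q q' * humbertRatRep q =
      humbertRatRep q * humbertRatRep q * humbertRatRep q' - humbertRatRep q' * (humbertRatRep q * humbertRatRep q) := by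
    simp only [humbertComm, mul_sub, sub_mul, Matrix.mul_assoc]
    abel
  rw [h1, hsq, sub_mul, mul_sub, smul_mul_assoc, mul_smul_comm, smul_mul_assoc, mul_smul_comm, one_mul, mul_one,
    humbertComm, smul_sub]
  abel

/-- The same for the second relation: `R₀′γ + γR₀′ = b′γ`. [cite: Runge1999EndomorphismRingsAbelianSurfaces, §6 Lemma 8 and proof of Thm. 7 (p. 295)] -/
theorem humbertRatRep_mul_humbertComm_add' (q q' : Fin 5 → ℤ) :
    humbertRatRep q' * humbertComm q q' + humbertComm q q' * humbertRatRep q' = q' 1 • humbertComm q q' := by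
  have h := humbertRatRep_mul_humbertComm_add q' q
  rw [humbertComm_swap, mul_neg, neg_mul, ← neg_add, smul_neg, neg_inj] at h
  exact h

/-- **RUNGE, proof of THEOREM 7: "`γ² = −n(γ) = (Δ(α, β)² − Δ(α)Δ(β))/4`"** — over `ℤ` in the form
`4γ² = (Δ(q, q′)² − Δ(q)Δ(q′))·1`; the scalar `−(Δ(q)Δ(q′) − Δ(q,q′)²) = −det S_Δ` is NEGATIVE exactly when the discriminant
matrix `S_Δ` of the pair is definite (at a point of `𝔥₂` on two different Humbert surfaces: FILE 3).
[cite: Runge1999EndomorphismRingsAbelianSurfaces, §6 proof of Thm. 7 (p. 295)] -/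
theorem four_smul_humbertComm_mul_self (q q' : Fin 5 → ℤ) :
    (4 : ℤ) • (humbertComm q q' * humbertComm q q') =
      (humbertPolar q q' ^ 2 - humbertInvariant q * humbertInvariant q') • (1 : Matrix _ _ ℤ) := by
  ext i j
  rcases i with i | i <;> rcases j with j | j <;> fin_cases i <;> fin_cases j <;>
    simp only [humbertComm, Matrix.mul_apply, Matrix.sub_apply, Matrix.smul_apply, Matrix.one_apply,
      smul_eq_mul, Fintype.sum_sum_type, Fin.sum_univ_two] <;>
    simp [humbertRatRep, humbertPolar, humbertInvariant] <;> ring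

/-- **`γ = 0` forces `det S_Δ = 0`**: if the two symmetric endomorphisms commute then `Δ(q, q′)² = Δ(q)Δ(q′)`.
[cite: Runge1999EndomorphismRingsAbelianSurfaces, §6 proof of Thm. 7 (p. 295)] -/
theorem humbertPolar_sq_eq_of_humbertComm_eq_zero {q q' : Fin 5 → ℤ} (h : humbertComm q q' = 0) :
    humbertPolar q q' ^ 2 = humbertInvariant q * humbertInvariant q' := by
  have h4 := four_smul_humbertComm_mul_self q q'
  rw [h, mul_zero, smul_zero] at h4
  have h00 := congr_fun (congr_fun h4 (Sum.inl 0)) (Sum.inl 0)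
  simp only [Matrix.zero_apply, Matrix.smul_apply, Matrix.one_apply_eq, smul_eq_mul, mul_one] at h00
  exact (sub_eq_zero.1 h00.symm)

end Commutator

/-! ## §4 The square roots `α₀ = 2R₀ − b`, `β₀ = 2R₀′ − b′`: a quaternionic set of relations over `ℤ` -/

section Sqrt

/-- **The trace-free symmetric endomorphism `α₀ = 2R₀(q) − b·1 = 2α − t(α)·1` with `α₀² = Δ(q)·1`** (row A4-59′
`two_smul_humbertRatRep_sub_sq`: "`(2f₀ − b)² = Δ`"). [cite: BirkenhakeWilhelm2003, §4 Prop. 4.3 (p. 1827)] [cite: Runge1999EndomorphismRingsAbelianSurfaces, §6 p. 294 ("`Δ(x) = t(x)² − 4n(x)`")] -/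
def humbertSqrt (q : Fin 5 → ℤ) : Matrix (Fin 2 ⊕ Fin 2) (Fin 2 ⊕ Fin 2) ℤ :=
  (2 : ℤ) • humbertRatRep q - q 1 • (1 : Matrix _ _ ℤ)

/-- Unfolding of `humbertSqrt`. [cite: BirkenhakeWilhelm2003, §4 Prop. 4.3 (p. 1827)] -/
theorem humbertSqrt_def (q : Fin 5 → ℤ) : humbertSqrt q = (2 : ℤ) • humbertRatRep q - q 1 • (1 : Matrix _ _ ℤ) := rfl

/-- `α₀ = 2X(m, q) − t(X(m,q))·1` for every trace parameter. [cite: Runge1999EndomorphismRingsAbelianSurfaces, §6 p. 294] -/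
theorem humbertSqrt_eq_two_smul_rosatiMatrix_sub (m : ℤ) (q : Fin 5 → ℤ) :
    humbertSqrt q = (2 : ℤ) • rosatiMatrix m q - redTrace m q • (1 : Matrix _ _ ℤ) := by
  rw [humbertSqrt, rosatiMatrix_eq_smul_one_add, redTrace, smul_add, smul_smul, add_smul]
  abel

/-- **`α₀² = Δ(q)·1`.** [cite: BirkenhakeWilhelm2003, §4 Prop. 4.3 (p. 1827)] -/
theorem humbertSqrt_mul_self (q : Fin 5 → ℤ) : humbertSqrt q * humbertSqrt q = humbertInvariant q • (1 : Matrix _ _ ℤ) :=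
  two_smul_humbertRatRep_sub_sq q

/-- `α₀` is Rosati invariant. [cite: BirkenhakeWilhelm2003, §4 Lemma 4.1 (p. 1827)] -/
theorem rosati_humbertSqrt (q : Fin 5 → ℤ) : rosati (typeForm (fun _ : Fin 2 ↦ 1)) (humbertSqrt q) = humbertSqrt q := by
  rw [humbertSqrt, rosati_sub, rosati_smul, rosati_smul, rosati_humbertRatRep, rosati_one isUnit_det_typeForm_one₁]

/-- `tr α₀ = 0`. [cite: Runge1999EndomorphismRingsAbelianSurfaces, §6 p. 294] -/
theorem trace_humbertSqrt (q : Fin 5 → ℤ) : (humbertSqrt q).trace = 0 := by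
  rw [humbertSqrt_eq_two_smul_rosatiMatrix_sub 0, Matrix.trace_sub, Matrix.trace_smul, Matrix.trace_smul,
    trace_rosatiMatrix_eq_two_mul_redTrace, Matrix.trace_one, Fintype.card_sum, Fintype.card_fin, smul_eq_mul,
    smul_eq_mul]
  ring

/-- **Lemma 8 on the square roots: `α₀β₀ + β₀α₀ = 2Δ(q, q′)·1`** — the anticommutator of the two trace-free symmetric
endomorphisms is the SCALAR `2Δ(α, β)`. [cite: Runge1999EndomorphismRingsAbelianSurfaces, §6 Lemma 8 (p. 295)] -/
theorem humbertSqrt_mul_add_mul (q q' : Fin 5 → ℤ) :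
    humbertSqrt q * humbertSqrt q' + humbertSqrt q' * humbertSqrt q = (2 * humbertPolar q q') • (1 : Matrix _ _ ℤ) := by
  have h8 := humbertRatRep_mul_add_mul q q'
  rw [humbertPolar_eq_mul_sub_two_mul_humbertNormPolar, humbertSqrt, humbertSqrt]
  have hL : ((2 : ℤ) • humbertRatRep q - q 1 • (1 : Matrix (Fin 2 ⊕ Fin 2) (Fin 2 ⊕ Fin 2) ℤ)) *
        ((2 : ℤ) • humbertRatRep q' - q' 1 • 1) +
      ((2 : ℤ) • humbertRatRep q' - q' 1 • 1) * ((2 : ℤ) • humbertRatRep q - q 1 • 1) =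
      (4 : ℤ) • (humbertRatRep q * humbertRatRep q' + humbertRatRep q' * humbertRatRep q) -
        (4 * q 1) • humbertRatRep q' - (4 * q' 1) • humbertRatRep q + (2 * q 1 * q' 1) • 1 := by
    rw [sub_mul, mul_sub, mul_sub, sub_mul, mul_sub, mul_sub]
    simp only [smul_mul_assoc, mul_smul_comm, one_mul, mul_one, smul_smul]
    module
  rw [hL, h8]
  module

/-- **`α₀β₀ − β₀α₀ = 4γ`.** [cite: Runge1999EndomorphismRingsAbelianSurfaces, §6 proof of Thm. 7 (p. 295)] -/
theorem humbertSqrt_mul_sub_mul (q q' : Fin 5 → ℤ) :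
    humbertSqrt q * humbertSqrt q' - humbertSqrt q' * humbertSqrt q = (4 : ℤ) • humbertComm q q' := by
  rw [humbertSqrt, humbertSqrt, humbertComm, sub_mul, mul_sub, mul_sub, sub_mul, mul_sub, mul_sub]
  simp only [smul_mul_assoc, mul_smul_comm, one_mul, mul_one, smul_smul]
  rw [mul_comm (q' 1) (q 1)]
  module

/-- **`2α₀β₀ = 2Δ(q,q′)·1 + 4γ`**: the product of the square roots in the basis `(1, γ)`.
[cite: Runge1999EndomorphismRingsAbelianSurfaces, §6 Lemma 8 and proof of Thm. 7 (p. 295)] -/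
theorem two_smul_humbertSqrt_mul (q q' : Fin 5 → ℤ) :
    (2 : ℤ) • (humbertSqrt q * humbertSqrt q') = (2 * humbertPolar q q') • (1 : Matrix _ _ ℤ) + (4 : ℤ) • humbertComm q q' := by
  rw [← humbertSqrt_mul_add_mul, ← humbertSqrt_mul_sub_mul, two_smul]
  abel

/-- **`α₀γ = −γα₀`: the commutator anticommutes with the square root `α₀`.**
[cite: Runge1999EndomorphismRingsAbelianSurfaces, §6 proof of Thm. 7 (p. 295)] -/
theorem humbertSqrt_mul_humbertComm (q q' : Fin 5 → ℤ) :
    humbertSqrt q * humbertComm q q' = -(humbertComm q q' * humbertSqrt q) := by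
  have h := humbertRatRep_mul_humbertComm_add q q'
  rw [humbertSqrt, sub_mul, mul_sub, smul_mul_assoc, mul_smul_comm, smul_mul_assoc, mul_smul_comm, one_mul, mul_one]
  rw [← sub_eq_zero]
  have : (2 : ℤ) • (humbertRatRep q * humbertComm q q') - q 1 • humbertComm q q' -
      -((2 : ℤ) • (humbertComm q q' * humbertRatRep q) - q 1 • humbertComm q q') =
      (2 : ℤ) • (humbertRatRep q * humbertComm q q' + humbertComm q q' * humbertRatRep q - q 1 • humbertComm q q') := by
    module
  rw [this, h, sub_self, smul_zero]

/-- `β₀γ = −γβ₀` likewise. [cite: Runge1999EndomorphismRingsAbelianSurfaces, §6 proof of Thm. 7 (p. 295)] -/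
theorem humbertSqrt_mul_humbertComm' (q q' : Fin 5 → ℤ) :
    humbertSqrt q' * humbertComm q q' = -(humbertComm q q' * humbertSqrt q') := by
  have h := humbertSqrt_mul_humbertComm q' q
  rw [humbertComm_swap, mul_neg, neg_mul, neg_neg] at h
  rw [← h, neg_neg]

/-- **`(2γ)² = (Δ(q,q′)² − Δ(q)Δ(q′))·1 = −det S_Δ · 1`.** [cite: Runge1999EndomorphismRingsAbelianSurfaces, §6 proof of Thm. 7 (p. 295)] -/
theorem two_smul_humbertComm_mul_self (q q' : Fin 5 → ℤ) :
    ((2 : ℤ) • humbertComm q q') * ((2 : ℤ) • humbertComm q q') =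
      (humbertPolar q q' ^ 2 - humbertInvariant q * humbertInvariant q') • (1 : Matrix _ _ ℤ) := by
  rw [smul_mul_assoc, mul_smul_comm, smul_smul, show (2 : ℤ) * 2 = 4 by norm_num, four_smul_humbertComm_mul_self]

/-- **`α₀ · 2γ · α₀⁻¹`-type relation: `α₀ (2γ) = −(2γ) α₀`** (the `k = ij = −ji` relation of a quaternionic basis
`i = α₀`, `j = 2γ`). [cite: Runge1999EndomorphismRingsAbelianSurfaces, §6 proof of Thm. 7 (p. 295)] -/
theorem humbertSqrt_mul_two_smul_humbertComm (q q' : Fin 5 → ℤ) :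
    humbertSqrt q * ((2 : ℤ) • humbertComm q q') = -(((2 : ℤ) • humbertComm q q') * humbertSqrt q) := by
  rw [mul_smul_comm, humbertSqrt_mul_humbertComm, smul_mul_assoc, smul_neg]

end Sqrt

end SiegelModuli

end Literature.AlgebraicGeometry.ModuliOfAbelianVarieties
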